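/-
Copyright (c) 2026 the pub-hodgecm-mathlib formalisation cell (harness21).  Prover seat hodgecm-mathlib-K2E5-p10 (g4), Track B «K2-LIT» ∕ h413
(`stmt-HodgeConjecture-24833`), line `K2_E3_EllipticInputs`, unit U12, §L leaf (LBGL-2b) brick (b-ii) — THE HEAD: THE BOREL-SLICE DENSITY
`W = c′ · 1[disc χ_X ∈ (Fˣ)²] · ‖disc χ_X‖_F^{-1∕2}` of `K × 𝔟 → 𝔤𝔩₂(F)` (the Lie–Weyl formula for the split Cartan, organised along the Bruhat cells of `GL₂(𝒪)`).
2026-09-04.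
-/
import Summits.HodgeConjecture.HodgeConjecture.Theorems.K2E3GL2BorelSliceKIntegral          -- ★ (this seat): the `K`-integral of the slice functional in chart coordinates
import Summits.HodgeConjecture.HodgeConjecture.Theorems.K2E3GL2DiscrInvSqrtLocallyIntegrable -- ★ p856597 (K2E3-p12 (g3)): `locallyIntegrable_sqrt_normAbs_discr_inv`
import HarnessLib

/-!
# K2_E3 road (h413), §L leaf (LBGL-2b), brick (b-ii) — the Borel-slice density of `𝔤𝔩₂(F)` (Lie–Weyl for `K × 𝔟 → 𝔤𝔩₂`)

Cell `pub/hodgecm-mathlib` (D-0151), Track B, seat K2E5-p10 (g4) (free E5 hand on the E3 §L line; §L lead K2E3-p12 (g4), dealer K2E3-plan (g2)).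
`--supports stmt-HodgeConjecture-24833 --as helper`; THEOREMS ONLY (no definition ∕ instance ∕ notation ∕ named fact ∕ `sorry`); never imports
`Cruxes/…/Lines`.  COUNT-NEUTRAL: (L-B_GL) :478 of U12 stays OPEN; with ★ p856988 (b-i) and ★ p857004 (the assembly over this head) the leaf (LBGL-2b)
`sig_K2E3GL2RegularNilpotentFourier` is inhabited by names.

THE RESULT (**`exists_borelSliceDensity`**, the head frozen on the K2 bus 2026-09-04T03:08:42Z and consumed token for token by ★ p857004
`gl2RegularNilpotentFourier_of_sliceDensity`).  For `F` a non-archimedean local field of characteristic `0`, `κ` a Haar measure on `K = GL₂(𝒪)`, `dx` an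
additive Haar measure on `F` and `μ𝔤` one on `𝔤𝔩₂(F)`, there is `W : 𝔤𝔩₂(F) → ℂ` — namely `W(X) = c′ · 1[disc χ_X ∈ (Fˣ)²] · (√‖disc χ_X‖_F)⁻¹`, `c′ > 0` —
locally integrable, locally constant on the regular semisimple set `{disc χ_X ∈ Fˣ}`, with `√‖disc χ_X‖ · ‖W(X)‖ ≤ c′`, and such that for every `f ∈ C_c^∞(𝔤𝔩₂(F))`
  `∫_K ∫_{F³} f(k [[r₀,r₁],[0,r₂]] k⁻¹) dx^{⊗3}(r) dκ(k) = ∫ f(X) W(X) dμ𝔤(X)`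
— the push-forward of `dκ ⊗ dB` under `(k, B) ↦ k B k⁻¹` is `W dμ𝔤`: twice-covered split regular semisimple classes with the Weyl Jacobian `‖disc‖^{1∕2}`,
nothing over the elliptic set.  Proof: ★ (C) `lintegral_glInt_sliceFunctional_eq` (the identity for all measurable `g ≥ 0`, in chart coordinates,
with the constant of ★ p857099's Bruhat-cell decomposition), transport `chart_* dx^{⊗4} ↦ μ𝔤` by Haar uniqueness (★ p856988 `isAddHaarMeasure_map_chart`),
the measure identity `Φ_*(κ ⊗ dx^{⊗3}) = W · μ𝔤`, and the Bochner dress for `f ∈ C_c^∞` (integrable against `W · μ𝔤` since `W ∈ L¹_loc`, ★ p856597).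
[HarishChandra1999AdmissibleDistributions, Thm. 4.4, Thm. 6.1, §7 (rank one: `μ̂_reg = c|η|^{-1∕2}` on the split set)] [Howe1974, §2] [Igusa1978, Ch. II §7]
HONEST LABEL: HC_CM is proved only modulo the 7 printed citations (2 remaining named inputs: hLiu418 = stmt-HodgeConjecture-24832, h413 =
stmt-HodgeConjecture-24833) until rung 0 closes; count-neutral helper.

## References
* [HarishChandra1999AdmissibleDistributions] Harish-Chandra (DeBacker–Sally), *Admissible Invariant Distributions on Reductive p-adic Groups* (1999),
  Thm. 4.4 p. 11, Thm. 6.1, §7.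
* [Howe1974] R. Howe, *The Fourier transform and germs of characters (case of `GL_n` over a `p`-adic field)*, Math. Ann. 208 (1974), §2.
* [Igusa1978] J.-I. Igusa, *Lectures on Forms of Higher Degree* (1978), Ch. II §7.
-/

set_option autoImplicit false
set_option linter.dupNamespace false   -- `Summit.HodgeConjecture.HodgeConjecture.…` (D-0017 nested layout; lakefile exemption for Summits)

noncomputable section

open MeasureTheory Measure Filter Topology Set
open scoped MatrixGroups NNReal ENNReal Pointwise
open ValuativeRel
open Literature.NumberTheory.Rogawski1990 Literature.NumberTheory.Automorphic Literature.NumberTheory.Automorphic.LocalFieldHaar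
open Literature.NumberTheory.GaloisRepresentations Literature.NumberTheory.GaloisRepresentations.IsNonarchimedeanLocalField
open Summit.HodgeConjecture.HodgeConjecture.Cruxes.H413.K2E3LocalFieldSquaresHensel
open Summit.HodgeConjecture.HodgeConjecture.Cruxes.H413.K2E3GL2RegularNilpotentFourierLineInversion
open Summit.HodgeConjecture.HodgeConjecture.Cruxes.H413.K2E3GL2BorelSliceKIntegral
open Summit.HodgeConjecture.HodgeConjecture.Cruxes.H413.K2E3NormalizedCharBddNearSemisimpleRegular

namespace Summit.HodgeConjecture.HodgeConjecture.Cruxes.H413.K2E3GL2BorelSliceDensity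

variable {F : Type*} [Field F] [ValuativeRel F] [TopologicalSpace F] [IsNonarchimedeanLocalField F]

/-! ## §1  The weight `w(D) = 1[D ∈ (Fˣ)²] (√‖D‖)⁻¹` is locally constant off `0` and bounded by `(√‖D‖)⁻¹` -/

/-- The non-squares form an open subset of `Fˣ` too: `{x | ¬ IsSquare x ∧ x ≠ 0}` is open (characteristic `≠ 2`). [cite: Serre1973CourseArithmetic, Ch. II §3.3] -/
theorem sqWeight_locallyConstant (h2 : (2 : F) ≠ 0) {D₀ : F} (hD₀ : D₀ ≠ 0) :
    ∀ᶠ D in 𝓝 D₀, {D : F | IsSquare D ∧ D ≠ 0}.indicator (fun D => (NNReal.sqrt (normAbs F D))⁻¹) D =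
      {D : F | IsSquare D ∧ D ≠ 0}.indicator (fun D => (NNReal.sqrt (normAbs F D))⁻¹) D₀ := by
  have hn0 : 0 < normAbs F D₀ := pos_iff_ne_zero.2 ((map_ne_zero (normAbs F)).2 hD₀)
  have h20 : 0 < normAbs F 2 := pos_iff_ne_zero.2 ((map_ne_zero (normAbs F)).2 h2)
  have h21 : normAbs F 2 ≤ 1 := normAbs_le_one_iff.2 (by
    have : (2 : F) = ((2 : 𝒪[F]) : F) := by norm_cast
    rw [this]; exact SetLike.coe_mem _)
  -- the ball `‖D − D₀‖ < ‖2‖² ‖D₀‖` (⊆ `‖D − D₀‖ < ‖D₀‖`)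
  have hcont : Continuous fun D : F => normAbs F (D - D₀) := continuous_normAbs.comp (continuous_id.sub continuous_const)
  have hU : {D : F | normAbs F (D - D₀) < normAbs F 2 ^ 2 * normAbs F D₀} ∈ 𝓝 D₀ := by
    refine (isOpen_lt hcont continuous_const).mem_nhds ?_
    simp only [mem_setOf_eq, sub_self, map_zero]
    exact mul_pos (pow_pos h20 2) hn0
  refine Filter.mem_of_superset hU fun D hD => ?_
  simp only [mem_setOf_eq] at hD
  have hD' : normAbs F (D - D₀) < normAbs F D₀ := by
    refine lt_of_lt_of_le hD ?_
    calc normAbs F 2 ^ 2 * normAbs F D₀ ≤ 1 * normAbs F D₀ := mul_le_mul_of_nonneg_right (pow_le_one₀ (by positivity) h21) (by positivity)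
      _ = normAbs F D₀ := one_mul _
  have hnorm : normAbs F D = normAbs F D₀ := by
    have h := normAbs_add_eq_of_lt hD'
    rwa [add_sub_cancel] at h
  have hDne : D ≠ 0 := by
    intro h; rw [h, map_zero] at hnorm; exact hn0.ne' hnorm.symm
  have hiff : IsSquare D ↔ IsSquare D₀ := by
    constructor
    · intro hsq
      have h' : normAbs F (D₀ - D) < normAbs F 2 ^ 2 * normAbs F D := by rw [← normAbs_neg, neg_sub, hnorm]; exact hD
      exact isSquare_of_normAbs_sub_lt h2 hsq hDne h'
    · intro hsq; exact isSquare_of_normAbs_sub_lt h2 hsq hD₀ hD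
  show {D : F | IsSquare D ∧ D ≠ 0}.indicator (fun D => (NNReal.sqrt (normAbs F D))⁻¹) D =
    {D : F | IsSquare D ∧ D ≠ 0}.indicator (fun D => (NNReal.sqrt (normAbs F D))⁻¹) D₀
  by_cases hsq : IsSquare D₀
  · rw [indicator_of_mem (show D ∈ {D : F | IsSquare D ∧ D ≠ 0} from ⟨hiff.2 hsq, hDne⟩),
      indicator_of_mem (show D₀ ∈ {D : F | IsSquare D ∧ D ≠ 0} from ⟨hsq, hD₀⟩), hnorm]
  · rw [indicator_of_notMem (show D ∉ {D : F | IsSquare D ∧ D ≠ 0} from fun h => hsq (hiff.1 h.1)),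
      indicator_of_notMem (show D₀ ∉ {D : F | IsSquare D ∧ D ≠ 0} from fun h => hsq h.1)]

/-- `√‖D‖ · w(D) ≤ 1` for the weight `w(D) = 1[D ∈ (Fˣ)²] (√‖D‖)⁻¹`. [folklore] -/
theorem sqrt_mul_sqWeight_le_one (D : F) :
    NNReal.sqrt (normAbs F D) * {D : F | IsSquare D ∧ D ≠ 0}.indicator (fun D => (NNReal.sqrt (normAbs F D))⁻¹) D ≤ 1 := by
  by_cases hD : D ∈ {D : F | IsSquare D ∧ D ≠ 0}
  · rw [indicator_of_mem hD]
    have h0 : NNReal.sqrt (normAbs F D) ≠ 0 := by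
      rw [ne_eq, NNReal.sqrt_eq_zero]; exact (map_ne_zero (normAbs F)).2 hD.2
    rw [mul_inv_cancel₀ h0]
  · rw [indicator_of_notMem hD, mul_zero]; exact zero_le_one

/-- `w(D) ≤ (√‖D‖)⁻¹`. [folklore] -/
theorem sqWeight_le (D : F) :
    {D : F | IsSquare D ∧ D ≠ 0}.indicator (fun D => (NNReal.sqrt (normAbs F D))⁻¹) D ≤ (NNReal.sqrt (normAbs F D))⁻¹ :=
  indicator_le_self _ _ D

/-! ## §2  THE HEAD: the Borel-slice density -/

section Head
variable [MeasurableSpace F] [BorelSpace F] [MeasurableSpace (GL (Fin 2) F)] [BorelSpace (GL (Fin 2) F)]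
  [MeasurableSpace (Matrix (Fin 2) (Fin 2) F)] [BorelSpace (Matrix (Fin 2) (Fin 2) F)]

/-- **(b-ii) THE BOREL-SLICE DENSITY OF `𝔤𝔩₂(F)` (Lie–Weyl for `K × 𝔟 → 𝔤𝔩₂`).**  For `F` a non-archimedean local field of characteristic `0` (`ψ` a continuous
non-trivial additive character, only used for the local integrability of `‖disc‖^{-1∕2}`), `μ𝔤` an additive Haar measure on `𝔤𝔩₂(F)`, `κ` a Haar measure on
`K = GL₂(𝒪)` and `dx` an additive Haar measure on `F`, there is `W : 𝔤𝔩₂(F) → ℂ` — namely `W(X) = c′·1[disc χ_X ∈ (Fˣ)²]·(√‖disc χ_X‖_F)⁻¹` with `c′ > 0`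
(`c′ = 2 κ{‖k₀₀‖ = 1}∕dx(𝒪) · (μ𝔤 ∕ chart_* dx^{⊗4})⁻¹`) — such that: `W` is locally integrable; for every `f ∈ C_c^∞(𝔤𝔩₂(F))`,
`∫_K ∫_{F³} f(k [[r₀,r₁],[0,r₂]] k⁻¹) dx^{⊗3}(r) dκ(k) = ∫ f(X) W(X) dμ𝔤(X)`; `W` is locally constant on the regular semisimple set `{disc χ_X ∈ Fˣ}`; and
`√‖disc χ_X‖·‖W(X)‖ ≤ c′` everywhere.  This is the Lie–Weyl formula for the split Cartan of `𝔤𝔩₂(F)` read through the Bruhat cells of `K`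
(★ p857099, ★ p857112, ★ p857153): split regular semisimple classes are covered twice with Jacobian `‖disc‖^{1∕2}`, elliptic classes not at all —
Harish-Chandra's `μ̂_reg = c·|η|^{-1∕2}·1_{split}` once combined with ★ p856988 (b-i).
[cite: HarishChandra1999AdmissibleDistributions, Thm. 4.4 p. 11, Thm. 6.1, §7] [cite: Howe1974, §2 Prop. 3] [cite: Igusa1978, Ch. II §7] -/
theorem exists_borelSliceDensity [CharZero F] {ψ : AddChar F Circle} (hψ : ψ.IsContinuousNontrivial)
    (μ𝔤 : Measure (Matrix (Fin 2) (Fin 2) F)) [μ𝔤.IsAddHaarMeasure]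
    (κ : Measure ↥(glInt 2 F)) [IsHaarMeasure κ] (dx : Measure F) [dx.IsAddHaarMeasure] :
    ∃ W : Matrix (Fin 2) (Fin 2) F → ℂ, LocallyIntegrable W μ𝔤 ∧
      (∀ f : Matrix (Fin 2) (Fin 2) F → ℂ, IsLocSmooth f →
        ∫ k : ↥(glInt 2 F), ∫ r : Fin 3 → F,
          f (((k : GL (Fin 2) F) : Matrix (Fin 2) (Fin 2) F) * !![r 0, r 1; 0, r 2] * ((((k : GL (Fin 2) F))⁻¹ : GL (Fin 2) F) : Matrix (Fin 2) (Fin 2) F))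
          ∂(Measure.pi fun _ : Fin 3 => dx) ∂κ = ∫ X, f X * W X ∂μ𝔤) ∧
      (∀ X : Matrix (Fin 2) (Fin 2) F, IsUnit X.charpoly.discr → ∀ᶠ Y in 𝓝 X, W Y = W X) ∧
      (∀ C : Set (Matrix (Fin 2) (Fin 2) F), IsCompact C → ∃ B : ℝ, ∀ X ∈ C,
        ((NNReal.sqrt (normAbs F X.charpoly.discr) : ℝ≥0) : ℝ) * ‖W X‖ ≤ B) := by
  classical
  haveI : T2Space F := (isLocalField F).toT2Space
  haveI : LocallyCompactSpace F := (isLocalField F).toLocallyCompactSpace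
  haveI : SecondCountableTopology F := secondCountableTopology_localField F
  haveI : LocallyCompactSpace (Matrix (Fin 2) (Fin 2) F) := Pi.locallyCompactSpace_of_finite
  haveI : SecondCountableTopology (Matrix (Fin 2) (Fin 2) F) := inferInstanceAs (SecondCountableTopology (Fin 2 → Fin 2 → F))
  haveI : BorelSpace ↥(glInt 2 F) := Subtype.borelSpace _
  haveI : CompactSpace ↥(glInt 2 F) := isCompact_iff_compactSpace.1 (isCompact_glInt 2 F)
  have h2 : (2 : F) ≠ 0 := two_ne_zero
  -- the weight `w`, the chart measure, the constants
  set S : Set F := {D : F | IsSquare D ∧ D ≠ 0} with hS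
  have hSm : MeasurableSet S := (isOpen_setOf_isSquare_and_ne_zero h2).measurableSet
  set w : F → ℝ≥0 := S.indicator fun D => (NNReal.sqrt (normAbs F D))⁻¹ with hw
  have hwm : Measurable w := ((NNReal.continuous_sqrt.measurable.comp measurable_normAbs).inv).indicator hSm
  have hwm' : Measurable (S.indicator fun D => (((NNReal.sqrt (normAbs F D))⁻¹ : ℝ≥0) : ℝ≥0∞)) :=
    ((NNReal.continuous_sqrt.measurable.comp measurable_normAbs).inv.coe_nnreal_ennreal).indicator hSm
  have hdiscm : Measurable fun X : Matrix (Fin 2) (Fin 2) F => X.charpoly.discr := continuous_discr_charpoly.measurable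
  set ν : Measure (Matrix (Fin 2) (Fin 2) F) :=
    Measure.map (fun x : Fin 4 → F => (!![x 1, x 2; x 0, x 3] : Matrix (Fin 2) (Fin 2) F)) (Measure.pi fun _ : Fin 4 => dx) with hν
  haveI : ν.IsAddHaarMeasure := isAddHaarMeasure_map_chart dx
  have huniq : μ𝔤 = μ𝔤.addHaarScalarFactor ν • ν := isAddLeftInvariant_eq_smul μ𝔤 ν
  set a : ℝ≥0 := μ𝔤.addHaarScalarFactor ν with ha
  have hapos : 0 < a := addHaarScalarFactor_pos_of_isAddHaarMeasure μ𝔤 ν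
  obtain ⟨c, hc0, hct, hK⟩ := lintegral_glInt_sliceFunctional_eq dx h2 κ
  -- the constant `c′ = c ∕ a` as a positive real, and the density
  set c' : ℝ≥0 := c.toNNReal * a⁻¹ with hc'
  have hcc : (c : ℝ≥0∞) = ((c.toNNReal : ℝ≥0) : ℝ≥0∞) := (ENNReal.coe_toNNReal hct).symm
  set W : Matrix (Fin 2) (Fin 2) F → ℂ := fun X => (((c' * w X.charpoly.discr : ℝ≥0) : ℝ) : ℂ) with hW
  have hWdens : Measurable fun X : Matrix (Fin 2) (Fin 2) F => c' * w X.charpoly.discr := (hwm.comp hdiscm).const_mul c'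
  have hWm : Measurable W := Complex.measurable_ofReal.comp (measurable_coe_nnreal_real.comp hWdens)
  have hnormW : ∀ X, ‖W X‖ = ((c' * w X.charpoly.discr : ℝ≥0) : ℝ) := fun X => by
    rw [hW]; simp only [Complex.norm_real, Real.norm_eq_abs, abs_of_nonneg (NNReal.coe_nonneg _)]
  -- (1) the `ℝ≥0∞` identity against `μ𝔤` for every measurable `g ≥ 0`
  have hchart : ∀ G : Matrix (Fin 2) (Fin 2) F → ℝ≥0∞, Measurable G →
      ∫⁻ y : Fin 4 → F, G !![y 1, y 2; y 0, y 3] ∂(Measure.pi fun _ : Fin 4 => dx) = ((a⁻¹ : ℝ≥0) : ℝ≥0∞) * ∫⁻ X, G X ∂μ𝔤 := by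
    intro G hG
    rw [← lintegral_map hG continuous_chart.measurable, ← hν]
    conv_rhs => rw [huniq]
    rw [lintegral_smul_measure, ENNReal.smul_def, smul_eq_mul, ← mul_assoc, ← ENNReal.coe_mul, inv_mul_cancel₀ hapos.ne',
      ENNReal.coe_one, one_mul]
  have hL : ∀ g : Matrix (Fin 2) (Fin 2) F → ℝ≥0∞, Measurable g →
      ∫⁻ k, ∫⁻ r : Fin 3 → F, g (((k : GL (Fin 2) F) : Matrix (Fin 2) (Fin 2) F) * !![r 0, r 1; 0, r 2] *
          ((((k : GL (Fin 2) F))⁻¹ : GL (Fin 2) F) : Matrix (Fin 2) (Fin 2) F)) ∂(Measure.pi fun _ : Fin 3 => dx) ∂κ =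
        ∫⁻ X, ((c' * w X.charpoly.discr : ℝ≥0) : ℝ≥0∞) * g X ∂μ𝔤 := by
    intro g hg
    have hGm : Measurable fun Y : Matrix (Fin 2) (Fin 2) F =>
        S.indicator (fun D => (((NNReal.sqrt (normAbs F D))⁻¹ : ℝ≥0) : ℝ≥0∞)) Y.charpoly.discr * g Y := (hwm'.comp hdiscm).mul hg
    rw [hK g hg, hchart _ hGm, ← mul_assoc, ← lintegral_const_mul _ hGm]
    refine lintegral_congr fun X => ?_
    simp only [hc', hw, ENNReal.coe_mul, ENNReal.coe_indicator, ← hcc]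
    ring
  -- (2) the measure identity `Φ_*(κ ⊗ dx³) = W · μ𝔤`
  set Φ : ↥(glInt 2 F) × (Fin 3 → F) → Matrix (Fin 2) (Fin 2) F := fun p =>
    ((p.1 : GL (Fin 2) F) : Matrix (Fin 2) (Fin 2) F) * !![p.2 0, p.2 1; 0, p.2 2] * ((((p.1 : GL (Fin 2) F))⁻¹ : GL (Fin 2) F) : Matrix (Fin 2) (Fin 2) F) with hΦ
  have hΦc : Continuous Φ := by
    refine (((Units.continuous_val.comp (continuous_subtype_val.comp continuous_fst))).mul ?_).mul
      (Units.continuous_coe_inv.comp (continuous_subtype_val.comp continuous_fst))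
    refine continuous_matrix fun i j => ?_
    fin_cases i <;> fin_cases j <;> simp <;> fun_prop
  have hΦm : Measurable Φ := hΦc.measurable
  have hmeas : (κ.prod (Measure.pi fun _ : Fin 3 => dx)).map Φ = μ𝔤.withDensity fun X => ((c' * w X.charpoly.discr : ℝ≥0) : ℝ≥0∞) := by
    ext A hA
    rw [Measure.map_apply hΦm hA, withDensity_apply _ hA, ← lintegral_indicator_one (hA.preimage hΦm),
      lintegral_prod _ ((measurable_one.indicator (hA.preimage hΦm)).aemeasurable)]
    have hind : ∀ p : ↥(glInt 2 F) × (Fin 3 → F), (Φ ⁻¹' A).indicator (1 : ↥(glInt 2 F) × (Fin 3 → F) → ℝ≥0∞) p = A.indicator 1 (Φ p) := by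
      intro p; simp only [Set.indicator_apply, mem_preimage, Pi.one_apply]
    simp_rw [hind]
    rw [hL (A.indicator 1) (measurable_one.indicator hA), ← lintegral_indicator hA]
    refine lintegral_congr fun X => ?_
    by_cases hX : X ∈ A
    · rw [indicator_of_mem hX, indicator_of_mem hX, Pi.one_apply, mul_one]
    · rw [indicator_of_notMem hX, indicator_of_notMem hX, mul_zero]
  -- (3) `W ∈ L¹_loc`
  have hWli : LocallyIntegrable W μ𝔤 := by
    have hbase := (K2E3GL2DiscrInvSqrtLocallyIntegrable.locallyIntegrable_sqrt_normAbs_discr_inv hψ μ𝔤).smul (c' : ℝ)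
    refine hbase.mono hWm.aestronglyMeasurable (Filter.Eventually.of_forall fun X => ?_)
    rw [hnormW, Pi.smul_apply, smul_eq_mul, Real.norm_eq_abs, abs_of_nonneg (mul_nonneg (NNReal.coe_nonneg _) (NNReal.coe_nonneg _)),
      NNReal.coe_mul]
    exact mul_le_mul_of_nonneg_left (NNReal.coe_le_coe.2 (sqWeight_le _)) (NNReal.coe_nonneg _)
  refine ⟨W, hWli, fun f hf => ?_, fun X hX => ?_, fun C _ => ⟨(c' : ℝ), fun X _ => ?_⟩⟩
  · -- (4) the Bochner identity for `f ∈ C_c^∞`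
    have hfm : Measurable f := hf.continuous.measurable
    -- integrability of `f ∘ Φ` on `K × F³`: its `L¹`-norm is `∫ ‖f‖ W dμ𝔤 < ∞`
    have hint : Integrable (fun p : ↥(glInt 2 F) × (Fin 3 → F) => f (Φ p)) (κ.prod (Measure.pi fun _ : Fin 3 => dx)) := by
      refine ⟨(hf.continuous.comp hΦc).aestronglyMeasurable, ?_⟩
      show ∫⁻ p, ‖f (Φ p)‖ₑ ∂(κ.prod (Measure.pi fun _ : Fin 3 => dx)) < ∞
      rw [← lintegral_map (hfm.enorm) hΦm, hmeas, lintegral_withDensity_eq_lintegral_mul _ hWdens.coe_nnreal_ennreal hfm.enorm]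
      -- `∫⁻ (c′ w) ‖f‖ₑ ≤ ∫⁻_{supp f} ‖W‖ₑ · sup ‖f‖ < ∞`
      obtain ⟨M, hM⟩ := hf.continuous.norm.bddAbove_range_of_hasCompactSupport hf.hasCompactSupport.norm
      have hK := (hWli.integrableOn_isCompact hf.hasCompactSupport).2
      have hM0 : 0 ≤ M := (norm_nonneg (f 0)).trans (hM ⟨0, rfl⟩)
      calc ∫⁻ X, (fun X => ((c' * w X.charpoly.discr : ℝ≥0) : ℝ≥0∞)) X * ‖f X‖ₑ ∂μ𝔤
          = ∫⁻ X in tsupport f, ((c' * w X.charpoly.discr : ℝ≥0) : ℝ≥0∞) * ‖f X‖ₑ ∂μ𝔤 := by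
            rw [← lintegral_indicator (isClosed_tsupport f).measurableSet]
            refine lintegral_congr fun X => ?_
            by_cases hX : X ∈ tsupport f
            · rw [indicator_of_mem hX]
            · rw [indicator_of_notMem hX, image_eq_zero_of_notMem_tsupport hX, enorm_zero, mul_zero]
        _ ≤ ∫⁻ X in tsupport f, ‖W X‖ₑ * ENNReal.ofReal M ∂μ𝔤 := by
            refine lintegral_mono fun X => ?_
            have h1 : (((c' * w X.charpoly.discr : ℝ≥0) : ℝ≥0∞)) = ‖W X‖ₑ := by
              rw [← ofReal_norm, hnormW, ENNReal.ofReal_coe_nnreal]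
            rw [h1]
            exact mul_le_mul' le_rfl (by rw [← ofReal_norm]; exact ENNReal.ofReal_le_ofReal (hM ⟨X, rfl⟩))
        _ = (∫⁻ X in tsupport f, ‖W X‖ₑ ∂μ𝔤) * ENNReal.ofReal M := lintegral_mul_const _ hWm.enorm
        _ < ∞ := ENNReal.mul_lt_top hK ENNReal.ofReal_lt_top
    calc ∫ k : ↥(glInt 2 F), ∫ r : Fin 3 → F,
          f (((k : GL (Fin 2) F) : Matrix (Fin 2) (Fin 2) F) * !![r 0, r 1; 0, r 2] * ((((k : GL (Fin 2) F))⁻¹ : GL (Fin 2) F) : Matrix (Fin 2) (Fin 2) F))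
          ∂(Measure.pi fun _ : Fin 3 => dx) ∂κ
        = ∫ p, f (Φ p) ∂(κ.prod (Measure.pi fun _ : Fin 3 => dx)) := (integral_prod _ hint).symm
      _ = ∫ X, f X ∂((κ.prod (Measure.pi fun _ : Fin 3 => dx)).map Φ) := (integral_map hΦm.aemeasurable hf.continuous.aestronglyMeasurable).symm
      _ = ∫ X, (c' * w X.charpoly.discr) • f X ∂μ𝔤 := by rw [hmeas, integral_withDensity_eq_integral_smul hWdens]
      _ = ∫ X, f X * W X ∂μ𝔤 := by
            refine integral_congr_ae (Filter.Eventually.of_forall fun X => ?_)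
            show ((c' * w X.charpoly.discr : ℝ≥0)) • f X = f X * W X
            simp only [hW, NNReal.smul_def, Complex.real_smul, mul_comm]
  · -- (5) local constancy on `{disc χ ≠ 0}`
    have hX0 : X.charpoly.discr ≠ 0 := hX.ne_zero
    have hev := (sqWeight_locallyConstant h2 hX0)
    have hcont : ContinuousAt (fun Y : Matrix (Fin 2) (Fin 2) F => Y.charpoly.discr) X := continuous_discr_charpoly.continuousAt
    filter_upwards [hcont.eventually hev] with Y hY
    rw [hW]
    simp only [hw]
    rw [hY]
  · -- (6) the bound `√‖disc‖ · ‖W‖ ≤ c′`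
    rw [hnormW, ← NNReal.coe_mul]
    refine NNReal.coe_le_coe.2 ?_
    calc NNReal.sqrt (normAbs F X.charpoly.discr) * (c' * w X.charpoly.discr)
        = c' * (NNReal.sqrt (normAbs F X.charpoly.discr) * w X.charpoly.discr) := mul_left_comm _ _ _
      _ ≤ c' * 1 := mul_le_mul' le_rfl (sqrt_mul_sqWeight_le_one _)
      _ = c' := mul_one _

end Head

end Summit.HodgeConjecture.HodgeConjecture.Cruxes.H413.K2E3GL2BorelSliceDensity

end
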